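import Summits.KontsevichZagierPeriods.KontsevichZagierPeriods.Theorems.LinRedNormalFormResidualBeyondGenusZeroDimOneSplit
import Summits.KontsevichZagierPeriods.KontsevichZagierPeriods.Theorems.LinRedNormalFormResidualBeyondGenusZeroDimOneTransfer
import Summits.KontsevichZagierPeriods.KontsevichZagierPeriods.Theorems.LinRedNormalFormResidualBeyondGenusZeroStrength
import Summits.KontsevichZagierPeriods.KontsevichZagierPeriods.Theorems.LinRedNormalFormGenusZeroValuesMzv
import Summits.KontsevichZagierPeriods.KontsevichZagierPeriods.Theorems.FermatIsogenyBetaLinearSectorGreen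
import Summits.KontsevichZagierPeriods.KontsevichZagierPeriods.Theorems.LinRedNormalFormResidualBeyondGenusZeroLadder
import Summits.KontsevichZagierPeriods.KontsevichZagierPeriods.Theorems.LinRedNormalFormResidualBeyondGenusZeroLadderTransfer

/-!
# `ResidualBeyondGenusZero` (stmt-KontsevichZagierPeriods-3917, route LinRedNormalForm) — line `dim-one-splice` (crux-strategist, 2026-08-17; lead skeleton v2, lead c15 2026-08-17; v4, lead c19 2026-08-17; v5, lead c20 2026-08-17)

v5 (lead c20, 2026-08-17): the registered stub set is UNCHANGED (stubs 1, 3, 4, 5; 0 delegable). What is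
new is the STRUCTURE THEOREM OF STUB 5, landed as Theorems/LinRedNormalFormResidualBeyondGenusZeroLadder.lean
(p159737; registered sub-goal `residualBeyondDimOne_iff_ladder`): writing `D_d` for the classes of the
`d`-dimensional representations and `RelKer d` for the RUNG "a vanishing element of
`closure (gzSet ∪ D_{d+1})` is congruent modulo `KZ.relations` to an element of `closure (gzSet ∪ D_d)`",
(i) every formal combination is exhausted by dimension modulo moves (slabs: one Newton–Leibniz move per
extra dimension), (ii) `stub_residualBeyondDimOne ↔ ∀ d ≥ 1, RelKer d` ON THE NOSE
(`dimOneResidualStub_iff_ladder` below), (iii) the crux is LOSSLESSLY the bottom rung plus the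
ladder, `ResidualBeyondGenusZero ↔ Bottom ∧ ∀ d ≥ 1, RelKer d` (`residualBeyondGenusZero_iff_bottom_and_ladder`),
with `Bottom` (vanishing elements of `closure (gzSet ∪ D₁)` reduce to genus zero) ⇐ pieces 1–2 and
`Bottom → DimOneSeparation` outright, (iv) peeling: `Residual d ↔ RelKer d ∧ Residual (d+1)` for every `d`
(`residual_succ_iff`) — the birth certificate of EVERY further split down the ladder. So promoting stub 5
(the outcome of c15–c19 and of this seating) now comes with its typed plan: the child
`ResidualBeyondDimOne` of SPLIT.md = `⋀_{d ≥ 1} RelKer d`, to be filed rung by rung (`RelKer 1`: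
dimension two → dimension one modulo genus zero — Legendre's relation, beta/Γ products, `ζ(2)` as an
area, Catalan-type 2-periods; then `Residual 2`, …), each rung RES-implied (`relKer_of_residualBeyondGenusZero`)
and kernel-implied, none a truncation of RES. §2b composes the crux from stubs 1, 3, 4 and the RUNGS.

v4 (lead c19, 2026-08-17): the registered stub set is UNCHANGED (1 = crux 10042, 3 = item 14838, 4 = declared
transcendence input, 5 = declared smaller residual; 0 delegable). What is new is the SPINE of piece 2: its
separation statement (Mix) is now read through the landed equivalence `mix_iff_transfer`
(Theorems/LinRedNormalFormResidualBeyondGenusZeroDimOneTransfer.lean, p157101, registered sub-goal of this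
line): (Mix) ⟺ (Transfer) — for every real `v` that is at once the value of a genus-zero combination and of
a one-dimensional combination, some genus-zero representative and some one-dimensional representative of `v`
are congruent modulo `KZ.relations`. (Transfer) holds unconditionally at rational `v` (`transfer_ratCast`, the
shared constant `[Δ₁, q]`), is summit-implied (`transfer_of_residualBeyondGenusZero`, `transfer_of_jointKernel`),
and follows from "every common value of the two sectors is rational" (`transfer_of_ratValues`) — which is
exactly what stubs 3 + 4 supply (`commonValues_ratCast_of`). Conjecturally the two sectors share NO irrational
value (multiple zeta values of weight ≥ 2 against real periods of curve type), so (Transfer) has no provable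
non-vacuous instance: every proof of piece 2 is either that transcendence statement or a fragment of
Conjecture 1. Hence no cut of piece 2 is cheaper than stubs 3 + 4, and the skeleton keeps them.

v3 (lead c15, 2026-08-17): stub 2 of v1 (the typed Green generator in `KZ.relations`) is DISCHARGED
by the tree — `FermatIsogeny.BetaLinearSector.greenInRelations` (Theorems/FermatIsogenyBetaLinearSectorGreen.lean,
UNCONDITIONAL: two-set CAD + sub-band move + engine + Green-of-engine, all landed by the BetaLinearSector /
GenusTwoRealPeriodCell leads) — so piece 1 `DimOneKernelInKZ` now follows from stub 1 `RealOnePeriodRelations`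
ALONE (`dimOneKernelInKZ_of_realOnePeriodRelations`), i.e. from the named fact `HuberWustholzCurvePeriods`
(`dimOneKernelInKZ_of_huberWustholzCurvePeriods`); v2's Green stubs 2a–2c are withdrawn (all three exist in the
tree verbatim). Stubs 5–6 of v1 stay merged into the declared stub 5 `stub_residualBeyondDimOne` (rung lemma
landed, `residualBeyondDimOne_of_dimTwoPieces`, p148287, with the split glue
`residualBeyondGenusZero_of_dimOnePieces`). Remaining stubs: 1 (crux 10042), 3 (item 14838), 4 (declared
transcendence input), 5 (declared residual); `residual_from_facts_and_stubs` records the closure modulo the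
named facts `HuberWustholzCurvePeriods` + `GenusZeroPeriodsMZV` and the two declared statements.

The crux is the route's DECLARED RESIDUAL `RES : ker eval ≤ relations ⊔ ⟨GZ⟩` (summit-strength:
`KontsevichZagierPeriods → RES`, Strength file; route re-audit RESTATED). This line is its BC2 REDIRECT:
the typed decomposition along the ONE-DIMENSIONAL sector

  `RES ⇐ DimOneKernelInKZ ∧ DimOneSeparation ∧ ResidualBeyondDimOne`

(assembly = the splice of `…Splice.lean` / `…DimOneSplit.lean`; import-light landing candidate
`residualBeyondGenusZero_of_dimOnePieces` attached as evidence `DimOnePieces.lean` on the item), with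
ONE REGISTERED SKELETON PER PIECE — two stubs each, six in all — and the kernel-checked composition
`ResidualBeyondGenusZero_of` concluding the crux BY NAME:

* piece 1 `DimOneKernelInKZ` (Conjecture 1, kernel form, on the one-dimensional sector)
  ⇐ `stub_realOnePeriodRelations` (= crux stmt-10042 of route SymplecticScissors, landed conditionally
  on the named fact `HuberWustholzCurvePeriods`, Huber–Wüstholz 2022 Thm 13.3 (2)) +
  `stub_greenInRelations` (= the registered stub of line `green-native-bands` of crux PlanarAreas
  stmt-4990) — composition `dimOne_kernel_le_relations` (landed p141329);
* piece 2 `DimOneSeparation` (a vanishing element of `closure (GZ ∪ D₁)` is, mod relations, a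
  genus-zero combination plus a VANISHING one-dimensional one) ⇐ `stub_genusZeroValues` (= the route's
  support item `GenusZeroValuesMzv`, stmt-14838: Brown's theorem typed at value level, KNOWN) +
  `stub_wordValuesCapDimOne` (the sector's transcendence input: a number in the subgroup generated by
  the MZV word values which is the value of a one-dimensional combination is RATIONAL — weights) —
  composition through `mix_of_ratValues` (landed p141329): the shared constant `[Δ₁, q]` is at once
  genus-zero and one-dimensional, so no move is needed;
* piece 3 `ResidualBeyondDimOne` (the smaller declared residual beyond `GZ ∪ D₁`) ⇐ the next rung of
  the dimension ladder: `stub_dimTwoRelativeKernel` (vanishing elements of `closure (GZ ∪ D₁ ∪ D₂)`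
  reduce modulo moves to `closure (GZ ∪ D₁)`: home of Legendre's relation, beta/Γ-products,
  ζ(2)-as-an-area, Catalan-type 2-periods) + `stub_residualBeyondDimTwo` (residual beyond dimension two).

Why it dodges the STUCK state of the crux (PICKED c0–c14: no eligible line; blocked-on
`KZKernelConjecture`): nothing here attacks `ker eval ≤ relations ⊔ ⟨GZ⟩` head-on; the line PEELS the
first sector on which the tree holds move-level content (dimension one: SymplecticScissors /
PlanarAreas / LowDimension) and leaves a strictly smaller declared residual, exactly the tenure split
the route header (RANKED CRUXES #8) and the planner hold of 2026-08-16 asked for.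

Disproof used (`Cruxes/ResidualBeyondGenusZero/Disproof.lean`, landed `Negative/*`): every `_false_without_`
theorem is honoured because every stub targets the FULL `KZ.relations` — rule (3) is used inside
`stub_greenInRelations` (two Newton–Leibniz moves on the band) and inside `stub_realOnePeriodRelations`
(R3/R5), rule (2) by the coordinate swap of the Green chain and the reparametrisations R3
(`residual_false_without_changeOfVariables`: translation pairs live in `D₁` and are relations by one
move, `Negative/RuleTwoOneMove`), additivity throughout (`residual_false_without_additivity`); no stub is
an instance of the refuted strengthenings `not_residualOnTheNose` / `not_residualUnique` (all
congruences are modulo relations, no uniqueness claimed); §6 (truncations are not weaker) is respected: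
pieces 2–3 are declared summit-implied statements, piece 1 is a sector KERNEL, not a truncation of RES.

References: M. Kontsevich, D. Zagier, *Periods* (2001), §1.2; A. Huber, G. Wüstholz, *Transcendence and
Linear Relations of 1-Periods* (2022), Thm 13.3 (2); F. Brown, Ann. ENS 42 (2009), Thm 1.1; A. Huber,
S. Müller-Stach, *Periods and Nori Motives* (2017), Conj. 13.2.1.
-/

noncomputable section

set_option linter.dupNamespace false

open MeasureTheory Set
open Literature.NumberTheory.Transcendental
open Literature.ModelTheory.ExponentialFields (IsSemialgebraic)
open Summit.KontsevichZagierPeriods.KontsevichZagierPeriods.Theses.LinRedNormalForm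
  (ResidualBeyondGenusZero GenusZeroValuesMzv)
open Summit.KontsevichZagierPeriods.KontsevichZagierPeriods.Theses.SymplecticScissors (RealOnePeriodRelations)
open Summit.KontsevichZagierPeriods.SymplecticScissors.RealOnePeriodRelationsNegative (greenSet H₁)
open Summit.KontsevichZagierPeriods.DihedralNormalForm.Negative
  (IsGenusZero wordRepSet wordValueSet eval_mem_closure_wordValueSet)
open Summit.KontsevichZagierPeriods.ResidualBeyondGenusZero
  (mix_of_ratValues dimOne_kernel_le_relations mix_iff_transfer mix_of_transfer transfer_of_ratValues
    transfer_ratCast transfer_of_residualBeyondGenusZero)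
open Summit.KontsevichZagierPeriods.ResidualBeyondGenusZero.Negative (gzSet gzSet_eq residual_iff)

namespace Summit.KontsevichZagierPeriods.KontsevichZagierPeriods.Cruxes.ResidualBeyondGenusZero.DimOneSplice

/-! ## §0 The three pieces (verbatim the children statements of the split; `children.json`) -/

/-- Piece 1: Conjecture 1, kernel form, on the one-dimensional sector `D₁`. -/
def DimOneKernelInKZ : Prop :=
  ∀ h ∈ AddSubgroup.closure (Set.range fun r : Literature.NumberTheory.Transcendental.KZ.IntegralRep 1 => Literature.NumberTheory.Transcendental.KZ.of r), Literature.NumberTheory.Transcendental.KZ.eval h = 0 → h ∈ Literature.NumberTheory.Transcendental.KZ.relations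

/-- Piece 2: separation of the one-dimensional part of a vanishing element of `closure (GZ ∪ D₁)`. -/
def DimOneSeparation : Prop :=
  ∀ m ∈ AddSubgroup.closure ({x : Literature.NumberTheory.Transcendental.KZ.FormalRep | ∃ (k : ℕ) (r : Literature.NumberTheory.Transcendental.KZ.IntegralRep k) (p : MvPolynomial (Fin k) ℚ) (a : Fin k → Fin k → ℕ) (b c : Fin k → ℕ), r.domain = {t | (∀ i, 0 < t i) ∧ (∀ i, t i < 1) ∧ StrictAnti t} ∧ Set.EqOn r.integrand (fun t => MvPolynomial.aeval t p / ((∏ i, t i ^ b i) * (∏ i, (1 - t i) ^ c i) * ∏ i, ∏ j, if i < j then (t i - t j) ^ a i j else 1)) r.domain ∧ x = Literature.NumberTheory.Transcendental.KZ.of r} ∪ Set.range fun r : Literature.NumberTheory.Transcendental.KZ.IntegralRep 1 => Literature.NumberTheory.Transcendental.KZ.of r), Literature.NumberTheory.Transcendental.KZ.eval m = 0 → ∃ g ∈ AddSubgroup.closure {x : Literature.NumberTheory.Transcendental.KZ.FormalRep | ∃ (k : ℕ) (r : Literature.NumberTheory.Transcendental.KZ.IntegralRep k) (p : MvPolynomial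 (Fin k) ℚ) (a : Fin k → Fin k → ℕ) (b c : Fin k → ℕ), r.domain = {t | (∀ i, 0 < t i) ∧ (∀ i, t i < 1) ∧ StrictAnti t} ∧ Set.EqOn r.integrand (fun t => MvPolynomial.aeval t p / ((∏ i, t i ^ b i) * (∏ i, (1 - t i) ^ c i) * ∏ i, ∏ j, if i < j then (t i - t j) ^ a i j else 1)) r.domain ∧ x = Literature.NumberTheory.Transcendental.KZ.of r}, ∃ h ∈ AddSubgroup.closure (Set.range fun r : Literature.NumberTheory.Transcendental.KZ.IntegralRep 1 => Literature.NumberTheory.Transcendental.KZ.of r), Literature.NumberTheory.Transcendental.KZ.eval h = 0 ∧ m - g - h ∈ Literature.NumberTheory.Transcendental.KZ.relations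

/-- Piece 3: the smaller declared residual, beyond `GZ ∪ D₁`. -/
def ResidualBeyondDimOne : Prop :=
  ∀ c : Literature.NumberTheory.Transcendental.KZ.FormalRep, Literature.NumberTheory.Transcendental.KZ.eval c = 0 → ∃ c₁ ∈ AddSubgroup.closure ({x : Literature.NumberTheory.Transcendental.KZ.FormalRep | ∃ (k : ℕ) (r : Literature.NumberTheory.Transcendental.KZ.IntegralRep k) (p : MvPolynomial (Fin k) ℚ) (a : Fin k → Fin k → ℕ) (b c : Fin k → ℕ), r.domain = {t | (∀ i, 0 < t i) ∧ (∀ i, t i < 1) ∧ StrictAnti t} ∧ Set.EqOn r.integrand (fun t => MvPolynomial.aeval t p / ((∏ i, t i ^ b i) * (∏ i, (1 - t i) ^ c i) * ∏ i, ∏ j, if i < j then (t i - t j) ^ a i j else 1)) r.domain ∧ x = Literature.NumberTheory.Transcendental.KZ.of r} ∪ Set.range fun r : Literature.NumberTheory.Transcendental.KZ.IntegralRep 1 => Literature.NumberTheory.Transcendental.KZ.of r), c - c₁ ∈ Literature.NumberTheory.Transcendental.KZ.relations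

/-- `D₁`: the classes of the one-dimensional representations. -/
abbrev D₁ : Set KZ.FormalRep := Set.range fun r : KZ.IntegralRep 1 => KZ.of r

/-- `D₂`: the classes of the two-dimensional representations. -/
abbrev D₂ : Set KZ.FormalRep := Set.range fun r : KZ.IntegralRep 2 => KZ.of r

/-! ## §1 Stubs (registered; the ONLY gaps of the line) -/

/-- **Stub 1 (piece 1, input half): `RealOnePeriodRelations`** — crux stmt-KontsevichZagierPeriods-10042
of route SymplecticScissors, verbatim: every vanishing element of `H₁ = closure D₁` lies in
`closure (1a ∪ 1b ∪ 2 ∪ Green)`. Landed CONDITIONALLY on the named fact `HuberWustholzCurvePeriods`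
(`SymplecticScissors.RealOnePeriodRelations.realOnePeriodRelations_of_huberWustholzCurvePeriods`); its
unconditional layers (rational, one elliptic curve) are landed too. [size XL; owned by its own lines] -/
theorem stub_realOnePeriodRelations : RealOnePeriodRelations := by
  sorry

/-! ### Stub 2 of v1 — DISCHARGED (v3): the typed Green generator lies in `KZ.relations`, unconditionally,
by `FermatIsogeny.BetaLinearSector.greenInRelations` (tree). -/

/-- **The typed Green generator lies in `KZ.relations`** — no longer a stub: the tree's Green lemma
(`Theorems/FermatIsogenyBetaLinearSectorGreen.lean`: two-set adapted CAD, one Newton–Leibniz move per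
sub-band, the engine down a band off a null set, Green = engine ×2 + swap + reflection + rule 1b).
Verbatim the registered `stub_greenInRelations` of v1 and of crux PlanarAreas (stmt-4990). -/
theorem greenInRelations : ∀ g ∈ greenSet, g ∈ KZ.relations :=
  Summit.KontsevichZagierPeriods.FermatIsogeny.BetaLinearSector.greenInRelations

/-- **Stub 3 (piece 2, known half): Brown's theorem typed at value level** — verbatim the route's
support item `GenusZeroValuesMzv` (stmt-KontsevichZagierPeriods-14838): the value of every absolutely
convergent genus-zero representation is the value of a `ℤ`-combination of MZV word representations
(BrownENS2009 Thm 1.1, Cor 8.3; a convergent word rep exists for every admissible word). KNOWN result,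
cite-level; formalising it is the stub. [size XL (formalisation of a printed theorem)] -/
theorem stub_genusZeroValues : GenusZeroValuesMzv := by
  sorry

/-- **Stub 4 (piece 2, transcendence half): MZV-span values that are one-dimensional period values are
rational.** For every `h ∈ H₁` whose value lies in the subgroup generated by the values `q·ζ(ε)` of
the MZV word representations (`wordValueSet`; = the `ℚ`-span of the MZVs and `1`), `eval h ∈ ℚ`.
Grading heuristic: MZVs have weight ≥ 2 (weight 0 = ℚ), real curve-type periods have weight ≤ 1, and a
number algebraic AND in the MZV span is rational; period-conjecture strength (declared input of the
sector, the analogue of the route's `HoffmanIndependence`), not implied by the summit as formalised.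
[size: declared transcendence input] -/
theorem stub_wordValuesCapDimOne :
    ∀ h ∈ H₁, KZ.eval h ∈ AddSubgroup.closure wordValueSet → ∃ q : ℚ, KZ.eval h = q := by
  sorry

/-- **Stub 5 (piece 3, declared): the smaller residual beyond `GZ ∪ D₁`** — every vanishing formal
combination is congruent modulo `KZ.relations` to an element of `closure (GZ ∪ D₁)`; verbatim the
child `ResidualBeyondDimOne` of `SPLIT.md` (over the named generator set `gzSet`, `gzSet_eq`).
DECLARED like its parent (summit-implied: `c₁ := 0` under `KZKernelConjecture`,
`relativeKernel_and_residual_of_kernel`); strictly weaker than the crux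
(`dimOne_split_of_residualBeyondGenusZero.1`). Its own plan — the next rung of the dimension ladder,
(relative kernel of the two-dimensional sector: Legendre's relation, beta/Γ products, `ζ(2)` as an
area, Catalan-type 2-periods) + (residual beyond dimension two) — is LANDED as the rung lemma
`residualBeyondDimOne_of_dimTwoPieces` (Theorems/…DimOnePieces.lean, p148287); v1 carried the two
halves as stubs 5–6, merged here (v2) since both are declared / crux-sized and not worker targets.
[size: declared residual] -/
theorem stub_residualBeyondDimOne :
    ∀ c : KZ.FormalRep, KZ.eval c = 0 →
      ∃ c₁ ∈ AddSubgroup.closure (gzSet ∪ D₁), c - c₁ ∈ KZ.relations := by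
  sorry

/-! ## §2 Sorry-free compositions: one per piece, then the crux by name -/

/-- Soundness, elementwise. -/
theorem eval_eq_zero_of_mem_relations {x : KZ.FormalRep} (hx : x ∈ KZ.relations) : KZ.eval x = 0 :=
  (AddMonoidHom.mem_ker).1 (KZ.relations_le_ker_eval_holds hx)

/-- **Piece 1 from stubs 1–2** (`dimOne_kernel_le_relations`, landed): `H₁` is by definition
`closure D₁`. -/
theorem dimOneKernelInKZ_of (h₁ : RealOnePeriodRelations) (h₂ : ∀ g ∈ greenSet, g ∈ KZ.relations) :
    DimOneKernelInKZ :=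
  fun h hh hh0 => dimOne_kernel_le_relations h₁ h₂ h hh hh0

/-- **Piece 1 from stub 1 alone** (v3): `RealOnePeriodRelations → DimOneKernelInKZ`, the Green
generator being discharged by the tree. -/
theorem dimOneKernelInKZ_of_realOnePeriodRelations (h₁ : RealOnePeriodRelations) : DimOneKernelInKZ :=
  dimOneKernelInKZ_of h₁ greenInRelations

/-- **Piece 1 over the literature**: Conjecture 1 (kernel form) on the one-dimensional sector from
the named fact `HuberWustholzCurvePeriods` (Huber–Wüstholz 2022, Thm 13.3 (2)) alone, through the
landed `realOnePeriodRelations_of_huberWustholzCurvePeriods` (stmt-10042) and the tree's Green lemma.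
CONDITIONAL on the named fact. [cite: HuberWustholz2022, Thm 13.3 (2)] -/
theorem dimOneKernelInKZ_of_huberWustholzCurvePeriods (hHW : HuberWustholzCurvePeriods) :
    DimOneKernelInKZ :=
  dimOneKernelInKZ_of_realOnePeriodRelations
    (Summit.KontsevichZagierPeriods.SymplecticScissors.RealOnePeriodRelations.realOnePeriodRelations_of_huberWustholzCurvePeriods
      hHW)

/-- Values of the genus-zero closure lie in the subgroup generated by the MZV word values, granted
Brown's theorem in the typing of `GenusZeroValuesMzv` (closure induction; soundness transports word
representations to word values, `eval_mem_closure_wordValueSet`). -/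
theorem eval_mem_closure_wordValueSet_of_mem_closure_gzSet (hB : GenusZeroValuesMzv) :
    ∀ g ∈ AddSubgroup.closure gzSet, KZ.eval g ∈ AddSubgroup.closure wordValueSet := by
  intro g hg
  induction hg using AddSubgroup.closure_induction with
  | mem x hx =>
    obtain ⟨k, r, ⟨p, a, b, c, hdom, hint⟩, rfl⟩ := hx
    obtain ⟨m, hm, hmv⟩ := hB k r p a b c hdom hint
    rw [KZ.eval_of, ← hmv]
    exact eval_mem_closure_wordValueSet hm
  | zero => simp
  | add x y _ _ hx hy => simpa using add_mem hx hy
  | neg x _ hx => simpa using neg_mem hx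

/-- The rational-shared-values hypothesis of `mix_of_ratValues` from stubs 3–4: if `eval g + eval h = 0`
then `eval h = -eval g` lies in the MZV value subgroup, hence is rational, hence so is `eval g`. -/
theorem ratValues_of (hB : GenusZeroValuesMzv)
    (hT : ∀ h ∈ H₁, KZ.eval h ∈ AddSubgroup.closure wordValueSet → ∃ q : ℚ, KZ.eval h = q) :
    ∀ g ∈ AddSubgroup.closure gzSet, ∀ h ∈ H₁, KZ.eval g + KZ.eval h = 0 → ∃ q : ℚ, KZ.eval g = q := by
  intro g hg h hh hgh
  have hval : KZ.eval h = -KZ.eval g := by linarith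
  have hmem : KZ.eval h ∈ AddSubgroup.closure wordValueSet := by
    rw [hval]
    exact neg_mem (eval_mem_closure_wordValueSet_of_mem_closure_gzSet hB g hg)
  obtain ⟨q, hq⟩ := hT h hh hmem
  refine ⟨-q, ?_⟩
  rw [Rat.cast_neg, ← hq, hval, neg_neg]

/-- **Piece 2 from stubs 3–4**: `mix_of_ratValues` (landed) over `ratValues_of`, read back through
`gzSet_eq` (the named generator set is the inlined one on the nose) and `H₁ = closure D₁`. -/
theorem dimOneSeparation_of (hB : GenusZeroValuesMzv)
    (hT : ∀ h ∈ H₁, KZ.eval h ∈ AddSubgroup.closure wordValueSet → ∃ q : ℚ, KZ.eval h = q) :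
    DimOneSeparation := by
  have key := mix_of_ratValues (ratValues_of hB hT)
  rw [gzSet_eq] at key
  exact key

/-! ### §2a Piece 2 through the TRANSFER form (v4; `mix_iff_transfer`, landed p157101) -/

/-- Stubs 3–4 say exactly: every COMMON VALUE of the genus-zero sector and the one-dimensional sector
is rational (Brown: genus-zero values lie in the MZV value subgroup; cap: MZV-subgroup values that are
one-dimensional values are rational). -/
theorem commonValues_ratCast_of (hB : GenusZeroValuesMzv)
    (hT : ∀ h ∈ H₁, KZ.eval h ∈ AddSubgroup.closure wordValueSet → ∃ q : ℚ, KZ.eval h = q) :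
    ∀ v : ℝ, (∃ g ∈ AddSubgroup.closure gzSet, KZ.eval g = v) → (∃ h ∈ H₁, KZ.eval h = v) →
      ∃ q : ℚ, v = q := by
  rintro v ⟨g, hg, rfl⟩ ⟨h, hh, hhv⟩
  obtain ⟨q, hq⟩ := hT h hh (hhv ▸ eval_mem_closure_wordValueSet_of_mem_closure_gzSet hB g hg)
  exact ⟨q, by rw [← hhv, hq]⟩

/-- **(Transfer) from stubs 3–4**: common values are rational, and rational values transfer with no
move (`transfer_ratCast`: the shared constant `[Δ₁, q]` is genus-zero AND one-dimensional). -/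
theorem transfer_of_stubs (hB : GenusZeroValuesMzv)
    (hT : ∀ h ∈ H₁, KZ.eval h ∈ AddSubgroup.closure wordValueSet → ∃ q : ℚ, KZ.eval h = q) :
    ∀ v : ℝ, (∃ g ∈ AddSubgroup.closure gzSet, KZ.eval g = v) → (∃ h ∈ H₁, KZ.eval h = v) →
      ∃ z ∈ AddSubgroup.closure gzSet, ∃ y ∈ H₁, KZ.eval z = v ∧ y - z ∈ KZ.relations :=
  transfer_of_ratValues (commonValues_ratCast_of hB hT)

/-- **Piece 2 from stubs 3–4 through the transfer form** (the v4 spine): (Transfer) from the stubs,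
then (Mix) = `DimOneSeparation` by `mix_of_transfer`, read back through `gzSet_eq`. Same hypotheses
as `dimOneSeparation_of`; the two proofs are interchangeable in `ResidualBeyondGenusZero_of`. -/
theorem dimOneSeparation_of_transfer (hB : GenusZeroValuesMzv)
    (hT : ∀ h ∈ H₁, KZ.eval h ∈ AddSubgroup.closure wordValueSet → ∃ q : ℚ, KZ.eval h = q) :
    DimOneSeparation := by
  have key := mix_of_transfer (transfer_of_stubs hB hT)
  rw [gzSet_eq] at key
  exact key

/-- **(Transfer) is summit-implied** (so registering piece 2 in transfer form would keep the split
lossless): the crux gives it (`transfer_of_residualBeyondGenusZero`), and the summit gives the crux. -/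
theorem transfer_of_summit (hS : KontsevichZagierPeriods) :
    ∀ v : ℝ, (∃ g ∈ AddSubgroup.closure gzSet, KZ.eval g = v) → (∃ h ∈ H₁, KZ.eval h = v) →
      ∃ z ∈ AddSubgroup.closure gzSet, ∃ y ∈ H₁, KZ.eval z = v ∧ y - z ∈ KZ.relations :=
  transfer_of_residualBeyondGenusZero
    (Summit.KontsevichZagierPeriods.ResidualBeyondGenusZero.residualBeyondGenusZero_of_kontsevichZagierPeriods hS)

/-- **Piece 3 from stub 5**, read back through `gzSet_eq`. -/
theorem residualBeyondDimOne_of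
    (h₅ : ∀ c : KZ.FormalRep, KZ.eval c = 0 →
      ∃ c₁ ∈ AddSubgroup.closure (gzSet ∪ D₁), c - c₁ ∈ KZ.relations) :
    ResidualBeyondDimOne := by
  rw [gzSet_eq] at h₅
  exact h₅

/-- The next rung, for the record (landed p148287): the two-dimensional relative kernel and the
residual beyond dimension two give stub 5. -/
theorem residualBeyondDimOne_stub_of_dimTwoPieces
    (h₅ : ∀ m ∈ AddSubgroup.closure ((gzSet ∪ D₁) ∪ D₂), KZ.eval m = 0 →
      ∃ c₁ ∈ AddSubgroup.closure (gzSet ∪ D₁), m - c₁ ∈ KZ.relations)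
    (h₆ : ∀ c : KZ.FormalRep, KZ.eval c = 0 →
      ∃ c₂ ∈ AddSubgroup.closure ((gzSet ∪ D₁) ∪ D₂), c - c₂ ∈ KZ.relations) :
    ∀ c : KZ.FormalRep, KZ.eval c = 0 →
      ∃ c₁ ∈ AddSubgroup.closure (gzSet ∪ D₁), c - c₁ ∈ KZ.relations := by
  intro c hc
  obtain ⟨c₂, hc₂, hcc₂⟩ := h₆ c hc
  have hc₂0 : KZ.eval c₂ = 0 := by
    have h := eval_eq_zero_of_mem_relations hcc₂
    rw [map_sub, hc, zero_sub, neg_eq_zero] at h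
    exact h
  obtain ⟨c₁, hc₁, h₂₁⟩ := h₅ c₂ hc₂ hc₂0
  refine ⟨c₁, hc₁, ?_⟩
  have e : c - c₁ = (c - c₂) + (c₂ - c₁) := by abel
  rw [e]
  exact add_mem hcc₂ h₂₁

/-- **The assembly of the split, inside the line**: pieces 1–3 give the residual onto `gzSet` — which
IS the crux (`residual_iff`; stated here in the `gzSet` form so that exactly the two theorems below
conclude the crux BY NAME) — by soundness + subgroup algebra; the Theorems-level twin is the landed
glue `residualBeyondGenusZero_of_dimOnePieces` (p148287). -/
theorem residual_of_pieces (hK : DimOneKernelInKZ) (hSep : DimOneSeparation)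
    (hRes : ResidualBeyondDimOne) :
    ∀ c : KZ.FormalRep, KZ.eval c = 0 →
      ∃ c₀ ∈ AddSubgroup.closure gzSet, c - c₀ ∈ KZ.relations := by
  intro c hc
  obtain ⟨c₁, hc₁, hcc₁⟩ := hRes c hc
  have hc₁0 : KZ.eval c₁ = 0 := by
    have h := eval_eq_zero_of_mem_relations hcc₁
    rw [map_sub, hc, zero_sub, neg_eq_zero] at h
    exact h
  obtain ⟨g, hg, h, hh, hh0, hsep⟩ := hSep c₁ hc₁ hc₁0
  refine ⟨g, by rw [gzSet_eq]; exact hg, ?_⟩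
  have e : c - g = (c - c₁) + (c₁ - g - h) + h := by abel
  rw [e]
  exact add_mem (add_mem hcc₁ hsep) (hK h hh hh0)

/-- **`ResidualBeyondGenusZero_of` — the line's kernel-checked composition, concluding the crux BY NAME.**
Its hypotheses are exactly the two registered OBLIGATIONS among the stubs (stub 1 =
`RealOnePeriodRelations`, crux stmt-10042; stub 3 = `GenusZeroValuesMzv`, item stmt-14838); the
other registered stubs enter as the declared `stub_*` theorems of this file: the transcendence input
(stub 4) and the declared smaller residual (stub 5); the Green statement is the tree's
`greenInRelations`. Order: piece 1 ⇐ stub 1 + Green; piece 2 ⇐ stubs 3–4; piece 3 ⇐ stub 5; crux ⇐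
pieces (`residual_of_pieces`, `residual_iff`). -/
theorem ResidualBeyondGenusZero_of (h₁ : RealOnePeriodRelations) (h₃ : GenusZeroValuesMzv) :
    Summit.KontsevichZagierPeriods.KontsevichZagierPeriods.Theses.LinRedNormalForm.ResidualBeyondGenusZero := by
  rw [residual_iff]
  exact residual_of_pieces (dimOneKernelInKZ_of h₁ greenInRelations)
    (dimOneSeparation_of_transfer h₃ stub_wordValuesCapDimOne)
    (residualBeyondDimOne_of stub_residualBeyondDimOne)

/-- The crux from the stubs as they stand (sorries only inside `stub_*`). -/
theorem residualBeyondGenusZero_from_stubs :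
    Summit.KontsevichZagierPeriods.KontsevichZagierPeriods.Theses.LinRedNormalForm.ResidualBeyondGenusZero :=
  ResidualBeyondGenusZero_of stub_realOnePeriodRelations stub_genusZeroValues

/-! ### §2b Stub 5 as the RUNGS of the dimension ladder (v5; Theorems/…Ladder.lean, p159737) -/

/-- **Stub 5 is, on the nose, the conjunction of the rungs `RelKer d`, `d ≥ 1`** (the landed ladder
theorem `residualBeyondDimOne_iff_ladder`, registered sub-goal of this line; `D₁` unfolds to
`Set.range (KZ.of : IntegralRep 1 → FormalRep)`). -/
theorem dimOneResidualStub_iff_ladder :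
    (∀ c : KZ.FormalRep, KZ.eval c = 0 →
      ∃ c₁ ∈ AddSubgroup.closure (gzSet ∪ D₁), c - c₁ ∈ KZ.relations) ↔
    ∀ d, 1 ≤ d → ∀ m ∈ AddSubgroup.closure (gzSet ∪ (Set.range fun r : KZ.IntegralRep (d + 1) => KZ.of r)),
      KZ.eval m = 0 →
      ∃ m' ∈ AddSubgroup.closure (gzSet ∪ (Set.range fun r : KZ.IntegralRep d => KZ.of r)),
        m - m' ∈ KZ.relations :=
  Summit.KontsevichZagierPeriods.ResidualBeyondGenusZero.residualBeyondDimOne_iff_ladder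

/-- The rungs, as the stubs stand (sorry exactly inside `stub_residualBeyondDimOne`). -/
theorem ladder_from_stubs :
    ∀ d, 1 ≤ d → ∀ m ∈ AddSubgroup.closure (gzSet ∪ (Set.range fun r : KZ.IntegralRep (d + 1) => KZ.of r)),
      KZ.eval m = 0 →
      ∃ m' ∈ AddSubgroup.closure (gzSet ∪ (Set.range fun r : KZ.IntegralRep d => KZ.of r)),
        m - m' ∈ KZ.relations :=
  dimOneResidualStub_iff_ladder.1 stub_residualBeyondDimOne

/-- **Peeling the first rung** (birth certificate of the NEXT split, `residual_succ_iff 1`, landed):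
stub 5 ↔ `RelKer 1` (dimension two → dimension one modulo genus zero) ∧ `Residual 2` (residual beyond
`gzSet ∪ D₂`) — an EQUIVALENCE, so splitting the promoted child `ResidualBeyondDimOne` into these two
pieces is lossless (BC2 (a),(c)); its Theorems-level `⇐` is also the rung lemma
`residualBeyondDimOne_of_dimTwoPieces` (p148287, dimension-`≤ 2` variant). -/
theorem dimOneResidualStub_iff_rungOne_and_residualDimTwo :
    (∀ c : KZ.FormalRep, KZ.eval c = 0 →
      ∃ c₁ ∈ AddSubgroup.closure (gzSet ∪ D₁), c - c₁ ∈ KZ.relations) ↔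
    (∀ m ∈ AddSubgroup.closure (gzSet ∪ D₂), KZ.eval m = 0 →
      ∃ m' ∈ AddSubgroup.closure (gzSet ∪ D₁), m - m' ∈ KZ.relations) ∧
    (∀ c : KZ.FormalRep, KZ.eval c = 0 →
      ∃ c₂ ∈ AddSubgroup.closure (gzSet ∪ D₂), c - c₂ ∈ KZ.relations) :=
  Summit.KontsevichZagierPeriods.ResidualBeyondGenusZero.residual_succ_iff 1

/-- **The crux from stubs 1, 3, 4 and the RUNGS** (v5 composition; interchangeable with
`ResidualBeyondGenusZero_of`): pieces 1–2 give the bottom rung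
(`bottom_of_kernel_of_separation`), the rungs give stub 5 (`residualBeyondDimOne_iff_ladder`), and
`residualBeyondGenusZero_iff_bottom_and_ladder` concludes the crux BY NAME. -/
theorem ResidualBeyondGenusZero_of_rungs (h₁ : RealOnePeriodRelations) (h₃ : GenusZeroValuesMzv)
    (hL : ∀ d, 1 ≤ d →
      ∀ m ∈ AddSubgroup.closure (gzSet ∪ (Set.range fun r : KZ.IntegralRep (d + 1) => KZ.of r)),
        KZ.eval m = 0 →
        ∃ m' ∈ AddSubgroup.closure (gzSet ∪ (Set.range fun r : KZ.IntegralRep d => KZ.of r)),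
          m - m' ∈ KZ.relations) :
    Summit.KontsevichZagierPeriods.KontsevichZagierPeriods.Theses.LinRedNormalForm.ResidualBeyondGenusZero := by
  have hSep : ∀ m ∈ AddSubgroup.closure (gzSet ∪ D₁), KZ.eval m = 0 →
      ∃ g ∈ AddSubgroup.closure gzSet, ∃ h ∈ AddSubgroup.closure D₁,
        KZ.eval h = 0 ∧ m - g - h ∈ KZ.relations := by
    have key := dimOneSeparation_of_transfer h₃ stub_wordValuesCapDimOne
    unfold DimOneSeparation at key
    rw [← gzSet_eq] at key
    exact key
  exact Summit.KontsevichZagierPeriods.ResidualBeyondGenusZero.residualBeyondGenusZero_of_pieces_and_ladder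
    (dimOneKernelInKZ_of h₁ greenInRelations) hSep hL

/-- The crux from the stubs through the rungs (sorries only inside `stub_*`; same closure as
`residualBeyondGenusZero_from_stubs`). -/
theorem residualBeyondGenusZero_from_stubs_via_rungs :
    Summit.KontsevichZagierPeriods.KontsevichZagierPeriods.Theses.LinRedNormalForm.ResidualBeyondGenusZero :=
  ResidualBeyondGenusZero_of_rungs stub_realOnePeriodRelations stub_genusZeroValues ladder_from_stubs

/-- **Lossless reading of the whole line** (v5): the crux is EQUIVALENT to the bottom rung plus the
rungs (`residualBeyondGenusZero_iff_bottom_and_ladder`, landed), the bottom rung follows from pieces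
1–2 and gives piece 2 back (`dimOneSeparation_of_bottom`); recorded here in the line's vocabulary. -/
theorem residualBeyondGenusZero_iff_bottom_and_rungs :
    Summit.KontsevichZagierPeriods.KontsevichZagierPeriods.Theses.LinRedNormalForm.ResidualBeyondGenusZero ↔
      (∀ m ∈ AddSubgroup.closure (gzSet ∪ D₁), KZ.eval m = 0 →
        ∃ g ∈ AddSubgroup.closure gzSet, m - g ∈ KZ.relations) ∧
      (∀ d, 1 ≤ d →
        ∀ m ∈ AddSubgroup.closure (gzSet ∪ (Set.range fun r : KZ.IntegralRep (d + 1) => KZ.of r)),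
          KZ.eval m = 0 →
          ∃ m' ∈ AddSubgroup.closure (gzSet ∪ (Set.range fun r : KZ.IntegralRep d => KZ.of r)),
            m - m' ∈ KZ.relations) :=
  Summit.KontsevichZagierPeriods.ResidualBeyondGenusZero.residualBeyondGenusZero_iff_bottom_and_ladder

/-- **The composition with every input explicit** (readable form; `gzSet` form of the crux, =
`ResidualBeyondGenusZero` by `residual_iff`): `RealOnePeriodRelations`, the Green statement,
`GenusZeroValuesMzv`, the transcendence input and the smaller residual give the crux. -/
theorem residual_of_inputs (h₁ : RealOnePeriodRelations) (h₂ : ∀ g ∈ greenSet, g ∈ KZ.relations)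
    (h₃ : GenusZeroValuesMzv)
    (h₄ : ∀ h ∈ H₁, KZ.eval h ∈ AddSubgroup.closure wordValueSet → ∃ q : ℚ, KZ.eval h = q)
    (h₅ : ∀ c : KZ.FormalRep, KZ.eval c = 0 →
      ∃ c₁ ∈ AddSubgroup.closure (gzSet ∪ D₁), c - c₁ ∈ KZ.relations) :
    ∀ c : KZ.FormalRep, KZ.eval c = 0 →
      ∃ c₀ ∈ AddSubgroup.closure gzSet, c - c₀ ∈ KZ.relations :=
  residual_of_pieces (dimOneKernelInKZ_of h₁ h₂) (dimOneSeparation_of h₃ h₄) (residualBeyondDimOne_of h₅)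

/-- **The same composition over the literature** (the line's conditional closure as it stands, in
the `gzSet` form of the crux): stubs 1 and 3 are LANDED conditionally on two named facts —
`HuberWustholzCurvePeriods` (Huber–Wüstholz 2022, Thm 13.3 (2);
`realOnePeriodRelations_of_huberWustholzCurvePeriods`) and `GenusZeroPeriodsMZV` (Brown 2009, Thm 1.1;
`genusZeroValuesMzv_proof`) — so the crux follows from those two published theorems, the Green
lemma (tree), the declared transcendence input 4 and the declared residual 5.
[cite: HuberWustholz2022, Thm 13.3 (2)] [cite: BrownENS2009, Thm 1.1] -/
theorem residual_of_facts (hHW : HuberWustholzCurvePeriods) (hBrown : GenusZeroPeriodsMZV)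
    (h₂ : ∀ g ∈ greenSet, g ∈ KZ.relations)
    (h₄ : ∀ h ∈ H₁, KZ.eval h ∈ AddSubgroup.closure wordValueSet → ∃ q : ℚ, KZ.eval h = q)
    (h₅ : ∀ c : KZ.FormalRep, KZ.eval c = 0 →
      ∃ c₁ ∈ AddSubgroup.closure (gzSet ∪ D₁), c - c₁ ∈ KZ.relations) :
    ∀ c : KZ.FormalRep, KZ.eval c = 0 →
      ∃ c₀ ∈ AddSubgroup.closure gzSet, c - c₀ ∈ KZ.relations :=
  residual_of_inputs
    (Summit.KontsevichZagierPeriods.SymplecticScissors.RealOnePeriodRelations.realOnePeriodRelations_of_huberWustholzCurvePeriods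
      hHW)
    h₂ (Summit.KontsevichZagierPeriods.LinRedNormalForm.genusZeroValuesMzv_proof hBrown) h₄ h₅

/-- **What the line is closed modulo, today** (in the `gzSet` form): the two named facts and the two
declared statements 4–5 (sorries exactly there; everything else is proved in the tree). -/
theorem residual_from_facts_and_stubs (hHW : HuberWustholzCurvePeriods) (hBrown : GenusZeroPeriodsMZV) :
    ∀ c : KZ.FormalRep, KZ.eval c = 0 →
      ∃ c₀ ∈ AddSubgroup.closure gzSet, c - c₀ ∈ KZ.relations :=
  residual_of_facts hHW hBrown greenInRelations stub_wordValuesCapDimOne stub_residualBeyondDimOne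

/-! ## §3 Records: the split loses nothing (every piece is implied by the crux / the summit) -/

/-- `π` has a ONE-DIMENSIONAL representation, `π = ∫_{ℝ¹} dx₀ / (1 + x₀²)` (KZ 2001 §1.1 eq. (1);
same data as `isRealPeriod_pi_holds`). -/
theorem exists_oneDimRep_pi : ∃ r : KZ.IntegralRep 1, r.value = Real.pi := by
  have hmp := MeasureTheory.volume_preserving_funUnique (Fin 1) ℝ
  have hfun : (fun y : Fin 1 → ℝ => MvPolynomial.aeval y (1 : MvPolynomial (Fin 1) ℚ) /
      MvPolynomial.aeval y (1 + MvPolynomial.X 0 ^ 2 : MvPolynomial (Fin 1) ℚ)) =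
      (fun x : ℝ => (1 + x ^ 2)⁻¹) ∘ MeasurableEquiv.funUnique (Fin 1) ℝ := by
    funext y
    simp
  have hq : ∀ y ∈ (univ : Set (Fin 1 → ℝ)),
      MvPolynomial.aeval y (1 + MvPolynomial.X 0 ^ 2 : MvPolynomial (Fin 1) ℚ) ≠ 0 := by
    intro y _
    have h : (0 : ℝ) < 1 + y 0 ^ 2 := by positivity
    simpa using h.ne'
  have hint : IntegrableOn (fun y : Fin 1 → ℝ => MvPolynomial.aeval y (1 : MvPolynomial (Fin 1) ℚ) /
      MvPolynomial.aeval y (1 + MvPolynomial.X 0 ^ 2 : MvPolynomial (Fin 1) ℚ)) univ := by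
    rw [integrableOn_univ, hfun]
    exact (hmp.integrable_comp_emb (MeasurableEquiv.measurableEmbedding _)).2 integrable_inv_one_add_sq
  refine ⟨KZ.IntegralRep.ofRational univ 1 (1 + MvPolynomial.X 0 ^ 2)
    Literature.ModelTheory.ExponentialFields.isSemialgebraic_univ hq hint, ?_⟩
  rw [KZ.IntegralRep.value_ofRational, Measure.restrict_univ, hfun]
  exact (hmp.integral_comp' fun x : ℝ => (1 + x ^ 2)⁻¹).trans integral_univ_inv_one_add_sq

/-- **Strength certificate for stub 4.** The transcendence input implies that `π` is NOT in the
subgroup generated by the MZV word values (`π` is not a `ℚ`-linear combination of `1` and multiple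
zeta values — note `ζ(2) = π²/6` IS): take the one-dimensional representation of `π`; were `π` in
the closure, stub 4 would make it rational, contradicting `irrational_pi`. That consequence is an
OPEN transcendence statement (no unconditional result separates `π` linearly from the MZVs), so
stub 4 is conjecture-grade: DECLARED, exactly like the route's `HoffmanIndependence`. -/
theorem pi_not_mem_closure_wordValueSet_of_stub_wordValuesCapDimOne
    (hT : ∀ h ∈ H₁, KZ.eval h ∈ AddSubgroup.closure wordValueSet → ∃ q : ℚ, KZ.eval h = q) :
    Real.pi ∉ AddSubgroup.closure wordValueSet := by
  intro hπ
  obtain ⟨r, hr⟩ := exists_oneDimRep_pi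
  have hH : KZ.of r ∈ H₁ := AddSubgroup.subset_closure ⟨r, rfl⟩
  obtain ⟨q, hq⟩ := hT (KZ.of r) hH (by rwa [KZ.eval_of, hr])
  rw [KZ.eval_of, hr] at hq
  exact irrational_pi ⟨q, hq.symm⟩

/-- Hence, as the stubs stand, `π ∉ closure wordValueSet` is recorded modulo stub 4 only. -/
theorem pi_not_mem_closure_wordValueSet_from_stubs : Real.pi ∉ AddSubgroup.closure wordValueSet :=
  pi_not_mem_closure_wordValueSet_of_stub_wordValuesCapDimOne stub_wordValuesCapDimOne

/-! **Sharper strength certificate for stub 4 (v5, LANDED as `transcendental_zeta_three_of_cap`,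
Theorems/LinRedNormalFormResidualBeyondGenusZeroCapStrength.lean, p160809): the transcendence input
implies that `ζ(3)` is TRANSCENDENTAL** (an algebraic `a` is the value of `[Δ₁, a] ∈ H₁`, so stub 4
makes the algebraic elements of the MZV value subgroup rational; `ζ(3) = multipleZeta [3]` is a word
value and is irrational by Apéry). Only the irrationality of `ζ(3)` is known, so stub 4 sits above a
named OPEN problem: declared, not a prover target. (Not restated here to keep this workfile's import
closure small; import that file for `transcendental_zeta_three_of_cap stub_wordValuesCapDimOne`.) -/

/-- **The bottom rung of the ladder in transfer form, in the line's vocabulary** (landed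
`bottom_iff_dimOneToGenusZero`, Theorems/…LadderTransfer.lean p160225; `H₁ = closure D₁` by `rfl`):
pieces 1–2 of this line prove exactly that every element of `H₁` whose value is a genus-zero value
is congruent modulo `KZ.relations` to a genus-zero combination. -/
theorem dimOneToGenusZero_of_pieces (hK : DimOneKernelInKZ)
    (hSep : ∀ m ∈ AddSubgroup.closure (gzSet ∪ D₁), KZ.eval m = 0 →
      ∃ g ∈ AddSubgroup.closure gzSet, ∃ h ∈ AddSubgroup.closure D₁,
        KZ.eval h = 0 ∧ m - g - h ∈ KZ.relations) :
    ∀ h ∈ H₁, (∃ g ∈ AddSubgroup.closure gzSet, KZ.eval g = KZ.eval h) →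
      ∃ g' ∈ AddSubgroup.closure gzSet, h - g' ∈ KZ.relations :=
  Summit.KontsevichZagierPeriods.ResidualBeyondGenusZero.bottom_iff_dimOneToGenusZero.1
    (Summit.KontsevichZagierPeriods.ResidualBeyondGenusZero.bottom_of_kernel_of_separation hK hSep)


/-- The crux gives back pieces 2 and 3 (`dimOne_split_of_residualBeyondGenusZero`, landed), and the
summit gives piece 1 (restriction of the kernel conjecture); so each piece is summit-implied and the
decomposition is an equivalence granted piece 1 — recorded for the birth certificate (BC2(c): a
consequence of S used toward S). -/
theorem pieces_of_summit (hS : KontsevichZagierPeriods) :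
    DimOneKernelInKZ ∧ DimOneSeparation ∧ ResidualBeyondDimOne := by
  have hKer : KZKernelConjecture := kzKernelConjecture_iff_isRational.mpr hS
  have hRES : ResidualBeyondGenusZero :=
    Summit.KontsevichZagierPeriods.ResidualBeyondGenusZero.residualBeyondGenusZero_of_kontsevichZagierPeriods hS
  have h23 := Summit.KontsevichZagierPeriods.ResidualBeyondGenusZero.dimOne_split_of_residualBeyondGenusZero hRES
  rw [gzSet_eq] at h23
  exact ⟨fun h _ hh0 => hKer h hh0, h23.2, h23.1⟩

end Summit.KontsevichZagierPeriods.KontsevichZagierPeriods.Cruxes.ResidualBeyondGenusZero.DimOneSplice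

end
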